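import Mathlib
import Literature.Computability.AlgebraicComplexity.SimultaneousDoubleProduct

/-!
# Swap symmetry of clustered SDPP families — stub `stub_leafSwap` of line `registered`
(clustered-charts reshape, kill-side calibration; crux `EisensteinValCertificates.HomocyclicSTPPDesigns`,
stmt-MatrixMultiplication-10647)

The line's open leaf concerns "clustered" SDPP families `(A_i, B_i)_{i<n}` in `ℤ/p` (tree `IsSDPP`,
Cohn–Kleinberg–Szegedy–Umans 2005, §4 Def. 4.1): the index set is partitioned into classes by
`cls : Fin n → Fin m`, and the diagonal difference sets `A_i − B_i` of indices in different classes
are disjoint.  This small stub records the `A ↔ B` symmetry of that notion, so that a neighbouring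
stub may assume without loss of generality `|A_i| ≤ |B_i|`:

* swapping the two families preserves the SDPP — clause (W) by commutativity of addition, clause
  (X) by negating the relation `(b − b') + (a − a') = 0` and reading the original clause (X) at the
  reversed index triple `(k, j, i)`;
* swapping preserves the clustering, because `B_i − A_i = −(A_i − B_i)` and negation is injective
  (proved membership-wise: a common element `b − a = b' − a'` of `B_i − A_i` and `B_j − A_j` gives
  the common element `a − b = a' − b'` of `A_i − B_i` and `A_j − B_j`).

Sources: H. Cohn, R. Kleinberg, B. Szegedy, C. Umans, *Group-theoretic algorithms for matrix
multiplication*, FOCS 2005, §4 Def. 4.1 (the SDPP).  The symmetry itself is folklore.  Not here: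
the packing inequalities, the comparison with `PrimeCyclicPowerGain`, or any SDPP family — those
are other stubs of the line.
-/

set_option linter.dupNamespace false
-- (single-conjunct summit: the namespace repeats `MatrixMultiplication`)

namespace Summit.MatrixMultiplication.MatrixMultiplication.Theorems.HomocyclicSTPPDesigns.ClusteredCharts

open Literature.Computability.AlgebraicComplexity Finset
open scoped Pointwise

/-- Swapping the two families of an SDPP family preserves the SDPP: clause (W) is symmetric by
commutativity of addition, and clause (X) for `(B, A)` at `(i, j, k)` is clause (X) for `(A, B)` at
`(k, j, i)` applied to the negated relation. [folklore] -/
private theorem leafSwap_isSDPP {H : Type*} [AddCommGroup H] {n : ℕ} {A B : Fin n → Finset H}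
    (hS : IsSDPP A B) : IsSDPP B A := by
  refine ⟨fun i b hb b' hb' a ha a' ha' h0 => ?_, fun i j k b hb b' hb' a ha a' ha' h0 => ?_⟩
  · -- (W): `(b - b') + (a - a') = 0` with `b, b' ∈ B i`, `a, a' ∈ A i`
    rw [add_comm] at h0
    obtain ⟨h1, h2⟩ := hS.dpp i ha ha' hb hb' h0
    exact ⟨h2, h1⟩
  · -- (X): `b ∈ B i`, `b' ∈ B j`, `a ∈ A j`, `a' ∈ A k`, `(b - b') + (a - a') = 0`;
    -- read the original clause (X) at `(k, j, i)` with the negated relation.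
    have h0' : (a' - a) + (b' - b) = 0 := by
      rw [← neg_eq_zero, ← h0]
      abel
    exact (hS.simultaneous ha' ha hb' hb h0').symm

/-- Disjointness of difference sets is preserved under swapping the two arguments of both
differences: `t - s = -(s - t)` and negation is injective.  Membership-wise: a common element
`b - a = b' - a'` of `t - s` and `t' - s'` yields the common element `a - b = a' - b'` of `s - t`
and `s' - t'`. [folklore] -/
private theorem leafSwap_disjoint {H : Type*} [AddCommGroup H] [DecidableEq H]
    {s t s' t' : Finset H} (h : Disjoint (s - t) (s' - t')) : Disjoint (t - s) (t' - s') := by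
  rw [Finset.disjoint_left] at h ⊢
  intro x hx hx'
  rw [Finset.mem_sub] at hx hx'
  obtain ⟨b, hb, a, ha, rfl⟩ := hx
  obtain ⟨b', hb', a', ha', he⟩ := hx'
  refine h (Finset.sub_mem_sub ha hb) ?_
  have he' : a - b = a' - b' := by
    rw [← neg_sub b a, ← he, neg_sub]
  rw [he']
  exact Finset.sub_mem_sub ha' hb'

/-- **Swap symmetry** (registered stub `stub_leafSwap` of line `registered`, clustered-charts
reshape): for an SDPP family `(A_i, B_i)_{i<n}` in `ℤ/p` whose diagonal difference sets
`A_i − B_i` are disjoint across the classes of `cls : Fin n → Fin m`, the swapped family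
`(B_i, A_i)_{i<n}` is again an SDPP family (Cohn–Kleinberg–Szegedy–Umans 2005, §4 Def. 4.1:
clause (W) by commutativity, clause (X) by negating the relation and reading it at `(k, j, i)`)
and its diagonal difference sets `B_i − A_i = −(A_i − B_i)` are again disjoint across classes.
[folklore] -/
theorem stub_leafSwap :
    ∀ (p n m : ℕ) (A B : Fin n → Finset (ZMod p)) (cls : Fin n → Fin m),
      IsSDPP A B → (∀ i j, cls i ≠ cls j → Disjoint (A i - B i) (A j - B j)) →
      IsSDPP B A ∧ (∀ i j, cls i ≠ cls j → Disjoint (B i - A i) (B j - A j)) := by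
  intro p n m A B cls hS hD
  exact ⟨leafSwap_isSDPP hS, fun i j hij => leafSwap_disjoint (hD i j hij)⟩

end Summit.MatrixMultiplication.MatrixMultiplication.Theorems.HomocyclicSTPPDesigns.ClusteredCharts
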